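import Literature.Analysis.Calculus.ExpDifferentialAdSeries
import Literature.MathematicalPhysics.QuantumFieldTheory.Balaban1983to89.B7Eq38Remainder

/-!
# Bałaban's renormalization group for 4-d lattice Yang–Mills — B7 §A (32)–(35) and the closed forms of
(36)–(38), (40)–(41): the differential of `exp` as the series `g(ad)` (`B7Eq32ExpDifferential`)

CITATION HEADER.  Cell `lit-balaban` (Phase-2 proof seat p28, gen 5; free-target row EXT:Varadarajan1974 / B7.Eq32).
Source: T. Bałaban, *Averaging operations for lattice gauge theories*, Commun. Math. Phys. **98**, 17–51 (1985)
[Balaban1985Averaging] (cell paper B7; journal page = PDF page + 16), §A pp. 22–23 [PDF 6–7], read from the page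
renders `b2b-balaban-ref1/pages/1985-cmp98-averaging/1985-cmp98-averaging-p006-x2.png`, `…-p007-x2.png`.
Reference [7] of the paper = V. S. Varadarajan, *Lie groups, Lie algebras, and their representations* (1974/1984),
Theorem 2.14.3 [Varadarajan1984]; the same theorem is Theorem 5.4 of [Hall2015] and Thm. 5 §1.2 of [Rossmann2002].

HONEST FRAMING (mega-formalization `lit-balaban`, verbatim): statement-level skeleton of published theorems with
citation tags; proofs where landed; nothing here is a claim about the Yang–Mills mass gap.  (v1.1: this framing line
added to the module docstring at referee ref-3's request N-g16-1; no declaration changed.)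

THE PRINTED TEXT (p. 22–23).  «We will treat the expression `ad_X Y` for a fixed `X` as a linear operator on a space
of matrices `Y`, and we will consider functions of this operator `f(ad_X)`. … Let us start with the following basic
formula (see [7, Theorem 2.14.3])
  `e^{−A(t)} (d/dt) e^{A(t)} = Σ_{n=0}^∞ ((−1)ⁿ/(n+1)!) (ad_{A(t)})ⁿ A′(t) = g(ad_{A(t)}) A′(t)`,            (32)
where `A(t)` is a differentiable matrix-valued function of `t`. The function `g(z)` defined by the above formula
is an entire function given by `g(z) = Σ_{n=0}^∞ ((−1)ⁿ/(n+1)!) zⁿ = (e^{−z} − 1)/(−z)` for `z ≠ 0`, `g(0) = 1`, (33)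
hence the function `g⁻¹(z) = 1/g(z)` is an analytic function in a neighborhood of `0`, more exactly for
`z ≠ 2kπi`, `k = ±1, ±2, …`, and we have the identities
  `g⁻¹(z) = −z/(e^{−z} − 1)`, `g⁻¹(−z) = g⁻¹(z) − z`, `g⁻¹(z) = 1 + ½z + …`.                              (34)
Defining `f(z) = g⁻¹(z) − ½z`, we have `f(−z) = f(z)`, so `f(z) = 1 + Σ_{p≥1} k_{2p} z^{2p}`,
`g⁻¹(z) = f(z) + ½z`, `g⁻¹(−z) = f(z) − ½z`.                                                              (35)
Using (32) we can derive easily the following formulas: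
  `∂Z(u,v)/∂u = g⁻¹(−ad_{Z(u,v)})X`, `∂Z(u,v)/∂v = g⁻¹(ad_{Z(u,v)})Y`.                                    (36)
… `Z(0,v) = vY`, `∂Z(0,v)/∂u = g⁻¹(−ad_{vY})X = g⁻¹(−v ad_Y)X`.                                          (37)
From this we get `(1/i) log e^{iX}e^{iY} = Y + g⁻¹(−i ad_Y)X + 𝓕(X; Y)`, `|𝓕(X; Y)| ≤ O(1)|X|²`              (38)
… `Z(u) = log e^{uX+Y}e^{−Y}`. (39) … `Z(u) = u g(−ad_Y)X + u² ∫₀¹ dt (1 − t) Z″(tu)`, (40) and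
`(1/i) log e^{iX+iY}e^{−iY} = g(−i ad_Y)X + O(|X|²)`. (41)»

WHAT THIS FILE PROVES (all kernel-checked; axioms `propext`/`Classical.choice`/`Quot.sound`).  The companion
`B7Eq38Remainder` (unit b2b-balaban-b07) typed (28), (36)–(41) with the linear terms kept as DERIVATIVE OPERATORS
(`D36`, `G40`, `deriv (Z28 X Y) 0`, …) characterised by the differential of `exp`, and recorded as NOT REPRODUCED
«(i) The closed forms of the linear terms, `∂_u Z(0) = g⁻¹(−ad_Y)X` (36)–(37) and `g(−ad_Y)X` (40), i.e. the
operator calculus `f(ad_X)` of p. 22 together with [7, Thm. 2.14.3] (32) and the elementary identities (33)–(35)».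
The generic Literature files `Analysis/Calculus/ExpDifferentialGSeries` (the entire function `g` on a Banach algebra,
(33)–(34) as operator identities) and `Analysis/Calculus/ExpDifferentialAdSeries` ([7, Thm. 2.14.3]:
`D exp_X(h) = e^{X} g(ad_X) h`, `HasFDerivAt`, Mathlib-only) now supply exactly that, and this file draws the B7
consequences in B7's setting — an arbitrary complete normed `ℂ`-algebra `𝔸`, as in `B7Eq38Remainder`:
* (32) AS PRINTED: `eq32` (curve `A : ℂ → 𝔸`), `eq32_real` (curve `A : ℝ → 𝔸`, «differentiable matrix-valued
  function of `t`»), both with the printed series `Σ_n ((−1)ⁿ/(n+1)!) (ad_{A(t)})ⁿ A′(t)`, and `eq32_g` (`= g(ad_{A(t)})A′(t)`);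
* (33) for the scalar function: `g_eq_tsum` (`g(z) = Σ (−1)ⁿzⁿ/(n+1)!`), `g_of_ne_zero` (`= (e^{−z} − 1)/(−z)`, `z ≠ 0`),
  `g_zero` (`g(0) = 1`), `differentiable_g` («an entire function»), `hasDerivAt_g_zero` (`g′(0) = −½`);
* (34): `gInv_eq_inv` (`g⁻¹(z) = 1/g(z)` on `ℂ`), `gInv_of_ne_zero` (`g⁻¹(z) = −z/(e^{−z} − 1)`), `gInv_neg_scalar`
  (`g⁻¹(−z) = g⁻¹(z) − z`, here for `|z| ≤ 1`), `gInv_zero`, `hasDerivAt_gInv_zero` (`g⁻¹(z) = 1 + ½z + …`: the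
  derivative of `g⁻¹` at `0` is `½`); (35): `f35`, `f35_neg` (`f(−z) = f(z)`), `gInv_eq_f35_add`, `gInv_neg_eq_f35_sub`
  — and the same identities for OPERATORS `T` with `‖T‖ ≤ 1` are the generic `ExpDifferential.gInv_neg` etc.;
* (36) IN CLOSED FORM on the printed domain `|uX| < ⅛`, `|vY| < ⅛` (`B7Eq38Remainder.dom28`):
  `partial_fst_Z2_eq` (`∂Z/∂u = g⁻¹(−ad_{Z(u,v)})X`) and `partial_snd_Z2_eq` (`∂Z/∂v = g⁻¹(ad_{Z(u,v)})Y`), from the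
  companion's characterisations `fderiv_exp_partial_fst_Z2` / `fderiv_exp_partial_snd_Z2` and the generic solver
  lemmas `gSer_neg_ad_apply_of_fderiv_eq` / `eq_gInv_neg_ad_of_fderiv_eq` (`D exp_Y(D) = X e^{Y} ⟹ g(−ad_Y)D = X ⟹
  D = g⁻¹(−ad_Y)X` for `‖Y‖ ≤ ½`) and `gSer_ad_apply_of_fderiv_eq` / `eq_gInv_ad_of_fderiv_eq` (`D exp_Y(D) = e^{Y} X ⟹
  D = g⁻¹(ad_Y)X`); here `‖Z(u,v)‖ ≤ 3/7` on the domain (`norm_Z2_le`);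
* (37): `deriv_Z28_eq_gInv` (`∂_u Z28(0) = g⁻¹(−ad_Y)X`, `‖Y‖ ≤ 1/12`), `partial_fst_Z2_zero` (`∂Z(0,v)/∂u =
  g⁻¹(−v ad_Y)X` for `|v|·‖Y‖ ≤ 1/12`);
* (38) WITH THE PRINTED LINEAR TERM: `D36_eq` (`D36 X Y = g⁻¹(−i ad_Y)X`) and `eq38_closed_form`
  (`(1/i) log e^{iX}e^{iY} = Y + g⁻¹(−i ad_Y)X + 𝓕(X;Y)`, `‖𝓕‖ ≤ 24‖X‖²` for `‖X‖ ≤ 1/20`, `‖Y‖ ≤ 1/12`);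
* (40)–(41): `deriv_Z39_eq_gSer` (`∂_u Z39(0) = g(−ad_Y)X`), `deriv_Z39_eq_tsum` (the series), `G40_eq`
  (`G40 X Y = g(−i ad_Y)X`), `eq41_closed_form` (`(1/i) log e^{iX+iY}e^{−iY} = g(−i ad_Y)X + R`, `‖R‖ ≤ 34‖X‖²`);
* the conjugation formula behind all of it, `exp_I_smul_ad_apply`: `e^{i ad_Y} h = e^{iY} h e^{−iY}` (Hall Prop. 3.35).

HONEST SCOPE.  (a) (34) «analytic … for `z ≠ 2kπi`»: the scalar closed form `g⁻¹(z) = −z/(e^{−z} − 1)` is proved for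
every `z ≠ 0` (Lean's `x/0 = 0` makes both sides `0` at the zeros of `g`), the identity `g⁻¹(−z) = g⁻¹(z) − z` and all
OPERATOR inversions for `‖z‖ ≤ 1` resp. `‖T‖ ≤ 1` (where `‖g(T) − 1‖ ≤ (e − 1)/2 < 1`), which covers every use in the
paper (`T = ±ad_Y`, `±i ad_Y`, `±ad_{Z(u,v)}` with `|Y|`, `|Z|` small); the maximal domain `z ≠ 2kπi` is not typed.
(b) (35) «`f(z) = 1 + Σ_{p≥1} k_{2p} z^{2p}`» (the Bernoulli-number expansion) is represented by the evenness
`f(−z) = f(z)` it expresses and by `g⁻¹′(0) = ½`; the coefficients `k_{2p}` are not named.  (c) The integral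
remainders of (37)/(40) stay as in `B7Eq38Remainder` (handled by the Cauchy estimate).  Nothing here is specific to
matrices: `𝔸` is any complete normed `ℂ`-algebra, as in the companion.
-/

noncomputable section

open NormedSpace Filter Topology Metric
open Complex (I I_ne_zero)
open scoped Nat

namespace Literature.MathematicalPhysics.QuantumFieldTheory.Balaban1983to89.B7Eq32ExpDifferential

open Literature.Analysis.Calculus.ExpDifferential
open B7Eq38Remainder MatrixLog

/-! ## §1  (33)–(35): the entire function `g`, its reciprocal near `0`, and `f(z) = g⁻¹(z) − ½z` -/

section Scalar

/-- (33), first member: `g(z) = Σ_{n≥0} ((−1)ⁿ/(n+1)!) zⁿ` (`g` = the generic `ExpDifferential.gSer ℂ` on the Banach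
algebra `ℂ`). [cite: Balaban1985Averaging, (33) p.22] -/
theorem g_eq_tsum (z : ℂ) : gSer ℂ z = ∑' n : ℕ, (-1) ^ n * ((n + 1)! : ℂ)⁻¹ * z ^ n := by
  rw [gSer_eq_tsum_neg_one_pow]
  simp only [smul_eq_mul]

/-- (33): `g(0) = 1`. [cite: Balaban1985Averaging, (33) p.22] -/
theorem g_zero : gSer ℂ (0 : ℂ) = 1 := gSer_zero

/-- (33), closed form: `g(z) = (e^{−z} − 1)/(−z)` for `z ≠ 0` (from `z·g(z) = 1 − e^{−z}`, `ExpDifferential.mul_gSer`).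
[cite: Balaban1985Averaging, (33) p.22] -/
theorem g_of_ne_zero {z : ℂ} (hz : z ≠ 0) : gSer ℂ z = (Complex.exp (-z) - 1) / (-z) := by
  have h := mul_gSer (𝕂 := ℂ) z
  rw [← congr_fun Complex.exp_eq_exp_ℂ (-z)] at h
  rw [eq_div_iff (neg_ne_zero.mpr hz)]
  linear_combination (-1 : ℂ) * h

/-- The coefficients `(−1)ⁿ/(n+1)!` of (33). [cite: Balaban1985Averaging, (33) p.22] -/
private def gc (n : ℕ) : ℂ := (-1) ^ n * ((n + 1)! : ℂ)⁻¹

/-- The coefficients of (33) are nonzero. [folklore] -/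
private theorem gc_ne_zero (n : ℕ) : gc n ≠ 0 := by
  simp [gc, Nat.factorial_ne_zero]

/-- `|(−1)ⁿ/(n+1)!| = 1/(n+1)!`. [folklore] -/
private theorem norm_gc (n : ℕ) : ‖gc n‖ = ((n + 1)! : ℝ)⁻¹ := by
  simp [gc, norm_inv]

/-- The series (33) has infinite radius of convergence (ratio test: `|c_{n+1}|/|c_n| = 1/(n+2) → 0`). [folklore] -/
private theorem gc_radius : (FormalMultilinearSeries.ofScalars ℂ gc).radius = ⊤ := by
  refine FormalMultilinearSeries.ofScalars_radius_eq_top_of_tendsto (E := ℂ) (c := gc)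
    (Eventually.of_forall gc_ne_zero) ?_
  have h : (fun n : ℕ => ‖gc n.succ‖ / ‖gc n‖) = fun n : ℕ => 1 / ((n : ℝ) + 2) := by
    funext n
    rw [norm_gc, norm_gc, Nat.succ_eq_add_one, Nat.factorial_succ (n + 1)]
    have h1 : ((n + 1)! : ℝ) ≠ 0 := by exact_mod_cast Nat.factorial_ne_zero _
    push_cast
    field_simp
    ring
  rw [h]
  have h2 : Tendsto (fun n : ℕ => 1 / ((n : ℝ) + 1)) atTop (𝓝 0) := tendsto_one_div_add_atTop_nhds_zero_nat
  have h3 := (tendsto_add_atTop_iff_nat 1).mpr h2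
  refine h3.congr fun n => ?_
  push_cast
  ring_nf

/-- `g` is the sum of its power series (33) about `0`, on all of `ℂ`. [folklore] -/
private theorem hasFPowerSeriesOnBall_g :
    HasFPowerSeriesOnBall (fun z : ℂ => gSer ℂ z) (FormalMultilinearSeries.ofScalars ℂ gc) 0 ⊤ := by
  have h := (FormalMultilinearSeries.ofScalars ℂ gc).hasFPowerSeriesOnBall (by rw [gc_radius]; exact ENNReal.zero_lt_top)
  rw [gc_radius] at h
  refine h.congr fun z _ => ?_
  change FormalMultilinearSeries.ofScalarsSum gc z = gSer ℂ z
  rw [FormalMultilinearSeries.ofScalars_sum_eq, gSer_eq_tsum_neg_one_pow]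
  rfl

/-- (33): «`g(z)` … is an entire function» — `g` is complex-differentiable on all of `ℂ`.
[cite: Balaban1985Averaging, (33) p.22] -/
theorem differentiable_g : Differentiable ℂ fun z : ℂ => gSer ℂ z := by
  have h := hasFPowerSeriesOnBall_g.differentiableOn
  rw [Metric.eball_top_eq_univ] at h
  exact differentiableOn_univ.mp h

/-- `g′(0) = −½` (the linear coefficient of (33)); whence `g⁻¹(z) = 1 + ½z + …` (34). [cite: Balaban1985Averaging, (33)–(34) p.22–23] -/
theorem hasDerivAt_g_zero : HasDerivAt (fun z : ℂ => gSer ℂ z) (-(1 / 2)) 0 := by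
  have h := hasFPowerSeriesOnBall_g.hasFPowerSeriesAt.hasDerivAt
  rw [FormalMultilinearSeries.ofScalars_apply_eq] at h
  norm_num [gc] at h
  exact h

/-- (34): on `ℂ` the generic `gInv` is the reciprocal, «`g⁻¹(z) = 1/g(z)`». [cite: Balaban1985Averaging, (34) p.23] -/
theorem gInv_eq_inv (z : ℂ) : gInv ℂ z = (gSer ℂ z)⁻¹ := by
  rw [gInv, Ring.inverse_eq_inv]

/-- (34): `g⁻¹(0) = 1`. [cite: Balaban1985Averaging, (34) p.23] -/
theorem gInv_zero : gInv ℂ (0 : ℂ) = 1 := by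
  rw [gInv_eq_inv, g_zero, inv_one]

/-- (34), first identity: «`g⁻¹(z) = −z/(e^{−z} − 1)`» (`z ≠ 0`). [cite: Balaban1985Averaging, (34) p.23] -/
theorem gInv_of_ne_zero {z : ℂ} (hz : z ≠ 0) : gInv ℂ z = -z / (Complex.exp (-z) - 1) := by
  rw [gInv_eq_inv, g_of_ne_zero hz, inv_div]

/-- (34), second identity: «`g⁻¹(−z) = g⁻¹(z) − z`», here for `|z| ≤ 1` (the generic operator identity
`ExpDifferential.gInv_neg` at `E = ℂ`). [cite: Balaban1985Averaging, (34) p.23] -/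
theorem gInv_neg_scalar {z : ℂ} (hz : ‖z‖ ≤ 1) : gInv ℂ (-z) = gInv ℂ z - z :=
  gInv_neg hz

/-- (34), third identity to first order: «`g⁻¹(z) = 1 + ½z + …`» — `g⁻¹` has derivative `½` at `0`.
[cite: Balaban1985Averaging, (34) p.23] -/
theorem hasDerivAt_gInv_zero : HasDerivAt (fun z : ℂ => gInv ℂ z) (1 / 2) 0 := by
  have h : HasDerivAt (fun z : ℂ => (gSer ℂ z)⁻¹) (1 / 2) 0 :=
    (hasDerivAt_g_zero.inv (by rw [g_zero]; exact one_ne_zero)).congr_deriv (by rw [g_zero]; norm_num)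
  simp only [gInv_eq_inv]
  exact h

/-- (35): `f(z) := g⁻¹(z) − ½z` (stated for an element of any complete normed algebra, in particular for `z ∈ ℂ` and
for operators `T = ad_X`). [cite: Balaban1985Averaging, (35) p.23] -/
def f35 {E : Type*} [NormedRing E] [NormedAlgebra ℂ E] [CompleteSpace E] (T : E) : E :=
  gInv ℂ T - (1 / 2 : ℂ) • T

/-- (35): «`f(−z) = f(z)`» (for `‖T‖ ≤ 1`; from `g⁻¹(−T) = g⁻¹(T) − T`). [cite: Balaban1985Averaging, (35) p.23] -/
theorem f35_neg {E : Type*} [NormedRing E] [NormedAlgebra ℂ E] [CompleteSpace E] {T : E} (hT : ‖T‖ ≤ 1) :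
    f35 (-T) = f35 T := by
  have key : -T + (1 / 2 : ℂ) • T = -((1 / 2 : ℂ) • T) := by
    rw [← neg_one_smul ℂ T, ← add_smul, ← neg_smul]; norm_num
  rw [f35, f35, gInv_neg hT, smul_neg, sub_neg_eq_add, sub_eq_add_neg (gInv ℂ T) T, add_assoc, key,
    ← sub_eq_add_neg]

/-- (35): «`g⁻¹(z) = f(z) + ½z`». [cite: Balaban1985Averaging, (35) p.23] -/
theorem gInv_eq_f35_add {E : Type*} [NormedRing E] [NormedAlgebra ℂ E] [CompleteSpace E] (T : E) :
    gInv ℂ T = f35 T + (1 / 2 : ℂ) • T := by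
  rw [f35, sub_add_cancel]

/-- (35): «`g⁻¹(−z) = f(z) − ½z`» (for `‖T‖ ≤ 1`). [cite: Balaban1985Averaging, (35) p.23] -/
theorem gInv_neg_eq_f35_sub {E : Type*} [NormedRing E] [NormedAlgebra ℂ E] [CompleteSpace E] {T : E}
    (hT : ‖T‖ ≤ 1) : gInv ℂ (-T) = f35 T - (1 / 2 : ℂ) • T := by
  rw [← f35_neg hT, f35, smul_neg, sub_neg_eq_add, add_sub_cancel_right]

end Scalar

/-! ## §2  (32) in B7's setting, and the conjugation formula `e^{i ad_Y} = Ad(e^{iY})` -/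

section Algebra

variable {𝔸 : Type*} [NormedRing 𝔸] [NormedAlgebra ℂ 𝔸] [CompleteSpace 𝔸]

/-- **(32) AS PRINTED** ([7, Thm. 2.14.3]) for a curve `A : ℂ → 𝔸` with derivative `A′` at `t`:
`e^{−A(t)} (d/dt) e^{A(t)} = Σ_{n≥0} ((−1)ⁿ/(n+1)!) (ad_{A(t)})ⁿ A′`. [cite: Balaban1985Averaging, (32) p.22] -/
theorem eq32 {A : ℂ → 𝔸} {A' : 𝔸} {t : ℂ} (hA : HasDerivAt A A' t) :
    exp (-A t) * deriv (fun t => exp (A t)) t = ∑' n : ℕ, ((-1) ^ n * ((n + 1)! : ℂ)⁻¹) • (ad ℂ (A t) ^ n) A' :=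
  exp_neg_mul_deriv_exp_comp_eq_tsum hA

/-- (32), last member: `e^{−A(t)} (d/dt) e^{A(t)} = g(ad_{A(t)}) A′(t)`. [cite: Balaban1985Averaging, (32) p.22] -/
theorem eq32_g {A : ℂ → 𝔸} {A' : 𝔸} {t : ℂ} (hA : HasDerivAt A A' t) :
    exp (-A t) * deriv (fun t => exp (A t)) t = gSer ℂ (ad ℂ (A t)) A' :=
  exp_neg_mul_deriv_exp_comp hA

omit [CompleteSpace 𝔸] in
/-- The iterated commutators do not depend on the scalar field: `(ad_ℝ X)ⁿ h = (ad_ℂ X)ⁿ h`. [folklore] -/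
private theorem ad_real_pow_apply (X h : 𝔸) (n : ℕ) : (ad ℝ X ^ n) h = (ad ℂ X ^ n) h := by
  induction n with
  | zero => simp
  | succ n ih => rw [ad_pow_succ_apply, ad_pow_succ_apply, ih]

/-- **(32) for a «differentiable matrix-valued function of `t`», `t` REAL**: the same formula for a curve
`A : ℝ → 𝔸` (the generic theorem over `𝕂 = ℝ`, rewritten with the `ℂ`-linear `ad`). [cite: Balaban1985Averaging, (32) p.22] -/
theorem eq32_real {A : ℝ → 𝔸} {A' : 𝔸} {t : ℝ} (hA : HasDerivAt A A' t) :
    exp (-A t) * deriv (fun t => exp (A t)) t = ∑' n : ℕ, ((-1) ^ n * ((n + 1)! : ℂ)⁻¹) • (ad ℂ (A t) ^ n) A' := by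
  rw [exp_neg_mul_deriv_exp_comp_eq_tsum (𝕂 := ℝ) hA]
  refine tsum_congr fun n => ?_
  rw [ad_real_pow_apply, ← Complex.coe_smul]
  push_cast
  rfl

omit [CompleteSpace 𝔸] in
/-- `‖i ad_Y‖ ≤ 2‖Y‖`, so `±i ad_Y` lies in the disc `‖T‖ ≤ 1` of (34) as soon as `‖Y‖ ≤ ½`. [folklore] -/
private theorem norm_I_smul_ad_le (Y : 𝔸) : ‖I • ad ℂ Y‖ ≤ 2 * ‖Y‖ := by
  rw [norm_smul, Complex.norm_I, one_mul]; exact norm_ad_le Y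

/-- The conjugation formula (Hall Prop. 3.35) in B7's normalisation: `e^{i ad_Y} h = e^{iY} h e^{−iY}`
(`i ad_Y = ad_{iY}`). [cite: Hall2015, Prop 3.35] -/
theorem exp_I_smul_ad_apply (Y h : 𝔸) : exp (I • ad ℂ Y) h = exp (I • Y) * h * exp (-(I • Y)) := by
  rw [← ad_smul, exp_ad_apply]

/-! ## §3  «Using (32) we can derive easily the following formulas» — solving `D exp_Y(D) = X e^{Y}` and
`D exp_Y(D) = e^{Y} X` for `D` ((36)) -/

/-- If `D exp_Y(D) = X e^{Y}` then `g(−ad_Y) D = X` (by (32): `D exp_Y(D) = e^{Y} g(ad_Y) D`, and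
`e^{Y} (g(ad_Y) D) e^{−Y} = e^{ad_Y} g(ad_Y) D = g(−ad_Y) D`). [cite: Balaban1985Averaging, (36) p.23] -/
theorem gSer_neg_ad_apply_of_fderiv_eq {Y D X : 𝔸} (h : fderiv ℂ exp Y D = X * exp Y) :
    gSer ℂ (-ad ℂ Y) D = X := by
  rw [fderiv_exp_apply (𝕂 := ℂ)] at h
  rw [← ad_neg, ← exp_ad_mul_gSer_ad, mul_apply_eq_comp, exp_ad_apply, h, mul_assoc,
    exp_mul_exp_neg_eq_one (𝕂 := ℂ), mul_one]

/-- … hence `D = g⁻¹(−ad_Y) X` when `‖Y‖ ≤ ½` (so that `‖ad_Y‖ ≤ 1` and `g(−ad_Y)` is inverted by (34)).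
[cite: Balaban1985Averaging, (36) p.23] -/
theorem eq_gInv_neg_ad_of_fderiv_eq {Y D X : 𝔸} (hY : ‖Y‖ ≤ 1 / 2) (h : fderiv ℂ exp Y D = X * exp Y) :
    D = gInv ℂ (-ad ℂ Y) X := by
  have hT : ‖-ad ℂ Y‖ ≤ 1 := by rw [norm_neg]; linarith [norm_ad_le (𝕂 := ℂ) Y]
  rw [← gSer_neg_ad_apply_of_fderiv_eq h, ← mul_apply_eq_comp, gInv_mul_gSer hT, one_apply_eq_self]

/-- If `D exp_Y(D) = e^{Y} X` then `g(ad_Y) D = X` (by (32) and `e^{−Y}e^{Y} = 1`). [cite: Balaban1985Averaging, (36) p.23] -/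
theorem gSer_ad_apply_of_fderiv_eq {Y D X : 𝔸} (h : fderiv ℂ exp Y D = exp Y * X) : gSer ℂ (ad ℂ Y) D = X := by
  have h' : exp (-Y) * fderiv ℂ exp Y D = exp (-Y) * (exp Y * X) := by rw [h]
  rwa [exp_neg_mul_fderiv_exp_apply (𝕂 := ℂ), ← mul_assoc, exp_neg_mul_exp_eq_one (𝕂 := ℂ), one_mul] at h'

/-- … hence `D = g⁻¹(ad_Y) X` when `‖Y‖ ≤ ½`. [cite: Balaban1985Averaging, (36) p.23] -/
theorem eq_gInv_ad_of_fderiv_eq {Y D X : 𝔸} (hY : ‖Y‖ ≤ 1 / 2) (h : fderiv ℂ exp Y D = exp Y * X) :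
    D = gInv ℂ (ad ℂ Y) X := by
  have hT : ‖ad ℂ Y‖ ≤ 1 := by linarith [norm_ad_le (𝕂 := ℂ) Y]
  rw [← gSer_ad_apply_of_fderiv_eq h, ← mul_apply_eq_comp, gInv_mul_gSer hT, one_apply_eq_self]

/-! ## §4  (36) on the printed domain and (37) -/

/-- On the printed domain `|uX| < ⅛`, `|vY| < ⅛` of (28): `‖Z(u,v)‖ ≤ 3/7` (`‖e^{uX}e^{vY} − 1‖ < 3/10` by
`B7Eq38Remainder.norm_arg2_sub_one_lt`, and `‖log W‖ ≤ |W − 1|/(1 − |W − 1|)`, `MatrixLog.norm_mlog_le_div`).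
[cite: Balaban1985Averaging, (28) p.22] -/
theorem norm_Z2_le {X Y : 𝔸} {p : ℂ × ℂ} (hp : p ∈ dom28 X Y) : ‖Z2 X Y p‖ ≤ 3 / 7 := by
  have h1 := norm_arg2_sub_one_lt hp
  have h2 := norm_mlog_le_div (h1.trans (by norm_num))
  have h3 := div_one_sub_mono h1.le (by norm_num : (3 / 10 : ℝ) < 1)
  have h4 : (3 / 10 : ℝ) / (1 - 3 / 10) = 3 / 7 := by norm_num
  change ‖mlog (exp (p.1 • X) * exp (p.2 • Y))‖ ≤ 3 / 7
  linarith

/-- **(36), FIRST CLAUSE, IN CLOSED FORM** on the printed domain: `∂Z(u,v)/∂u = g⁻¹(−ad_{Z(u,v)}) X`.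
[cite: Balaban1985Averaging, (36) p.23] -/
theorem partial_fst_Z2_eq {X Y : 𝔸} {u v : ℂ} (hp : (u, v) ∈ dom28 X Y) :
    deriv (fun u' : ℂ => Z2 X Y (u', v)) u = gInv ℂ (-ad ℂ (Z2 X Y (u, v))) X :=
  eq_gInv_neg_ad_of_fderiv_eq ((norm_Z2_le hp).trans (by norm_num)) (fderiv_exp_partial_fst_Z2 hp)

/-- **(36), SECOND CLAUSE, IN CLOSED FORM** on the printed domain: `∂Z(u,v)/∂v = g⁻¹(ad_{Z(u,v)}) Y`.
[cite: Balaban1985Averaging, (36) p.23] -/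
theorem partial_snd_Z2_eq {X Y : 𝔸} {u v : ℂ} (hp : (u, v) ∈ dom28 X Y) :
    deriv (fun v' : ℂ => Z2 X Y (u, v')) v = gInv ℂ (ad ℂ (Z2 X Y (u, v))) Y :=
  eq_gInv_ad_of_fderiv_eq ((norm_Z2_le hp).trans (by norm_num)) (fderiv_exp_partial_snd_Z2 hp)

/-- (36)/(37) in the companion's one-variable form: `g(−ad_Y) (∂_u Z28(0)) = X` for `‖Y‖ ≤ 1/12`.
[cite: Balaban1985Averaging, (36)–(37) p.23] -/
theorem gSer_neg_ad_deriv_Z28 (X : 𝔸) {Y : 𝔸} (hY : ‖Y‖ ≤ 1 / 12) :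
    gSer ℂ (-ad ℂ Y) (deriv (Z28 X Y) 0) = X :=
  gSer_neg_ad_apply_of_fderiv_eq (fderiv_exp_deriv_Z28 X hY)

/-- **(37) IN CLOSED FORM**: `∂_u Z28(0) = g⁻¹(−ad_Y) X` for `‖Y‖ ≤ 1/12` (print: `∂Z(0,v)/∂u = g⁻¹(−ad_{vY})X`, with
`vY ↦ Y`). [cite: Balaban1985Averaging, (37) p.23] -/
theorem deriv_Z28_eq_gInv (X : 𝔸) {Y : 𝔸} (hY : ‖Y‖ ≤ 1 / 12) :
    deriv (Z28 X Y) 0 = gInv ℂ (-ad ℂ Y) X :=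
  eq_gInv_neg_ad_of_fderiv_eq (hY.trans (by norm_num)) (fderiv_exp_deriv_Z28 X hY)

/-- **(37) AS PRINTED, with the parameter `v`**: `∂Z(0,v)/∂u = g⁻¹(−v ad_Y) X` whenever `|v|·‖Y‖ ≤ 1/12`
(`Z(u,v) = Z2 X Y (u,v) = Z28 X (vY) u`, `ad_{vY} = v ad_Y`). [cite: Balaban1985Averaging, (37) p.23] -/
theorem partial_fst_Z2_zero (X : 𝔸) {Y : 𝔸} {v : ℂ} (hv : ‖v‖ * ‖Y‖ ≤ 1 / 12) :
    deriv (fun u : ℂ => Z2 X Y (u, v)) 0 = gInv ℂ (-(v • ad ℂ Y)) X := by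
  have hvY : ‖v • Y‖ ≤ 1 / 12 := by rwa [norm_smul]
  rw [← ad_smul]
  exact deriv_Z28_eq_gInv X hvY

/-! ## §5  (38) and (40)–(41) with the printed linear terms `g⁻¹(−i ad_Y)X`, `g(−i ad_Y)X` -/

/-- `D36 X Y = g⁻¹(−i ad_Y) X` for `‖Y‖ ≤ 1/12`: the linear term of (38) in its printed closed form.
[cite: Balaban1985Averaging, (38) p.23] -/
theorem D36_eq (X : 𝔸) {Y : 𝔸} (hY : ‖Y‖ ≤ 1 / 12) : D36 X Y = gInv ℂ (-(I • ad ℂ Y)) X := by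
  have hY' : ‖(I • Y : 𝔸)‖ ≤ 1 / 12 := by rwa [norm_I_smul']
  rw [D36, deriv_Z28_eq_gInv (I • X) hY', map_smul, smul_smul, inv_mul_cancel₀ I_ne_zero, one_smul, ad_smul]

/-- The linear term of (38) solves `g(−i ad_Y) D = X`. [cite: Balaban1985Averaging, (38) p.23] -/
theorem gSer_D36 (X : 𝔸) {Y : 𝔸} (hY : ‖Y‖ ≤ 1 / 12) : gSer ℂ (-(I • ad ℂ Y)) (D36 X Y) = X := by
  have hT : ‖-(I • ad ℂ Y)‖ ≤ 1 := by rw [norm_neg]; linarith [norm_I_smul_ad_le Y]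
  rw [D36_eq X hY, ← mul_apply_eq_comp, gSer_mul_gInv hT, one_apply_eq_self]

/-- **(38) AS PRINTED, LINEAR TERM INCLUDED**: for `‖X‖ ≤ 1/20`, `‖Y‖ ≤ 1/12`,
`(1/i) log e^{iX}e^{iY} = Y + g⁻¹(−i ad_Y)X + 𝓕(X; Y)` with `‖𝓕(X; Y)‖ ≤ 24‖X‖²` (`𝓕 = B7Eq38Remainder.F38`; the
constant from `B7Eq38Remainder.eq38_printed`). [cite: Balaban1985Averaging, (38) p.23] -/
theorem eq38_closed_form {X Y : 𝔸} (hX : ‖X‖ ≤ 1 / 20) (hY : ‖Y‖ ≤ 1 / 12) :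
    (I⁻¹ : ℂ) • mlog (exp (I • X) * exp (I • Y)) = Y + gInv ℂ (-(I • ad ℂ Y)) X + F38 X Y ∧
      ‖F38 X Y‖ ≤ 24 * ‖X‖ ^ 2 := by
  rw [← D36_eq X hY]
  exact eq38_printed hX hY

/-- **(40), THE LINEAR TERM IN CLOSED FORM**: `∂_u Z39(0) = g(−ad_Y) X` for `‖Y‖ ≤ 1/12` (companion:
`∂_u Z39(0) = D exp_Y(X) e^{−Y}`; (32): `= e^{Y} (g(ad_Y)X) e^{−Y} = e^{ad_Y} g(ad_Y) X = g(−ad_Y) X`).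
[cite: Balaban1985Averaging, (40) p.23] -/
theorem deriv_Z39_eq_gSer (X : 𝔸) {Y : 𝔸} (hY : ‖Y‖ ≤ 1 / 12) : deriv (Z39 X Y) 0 = gSer ℂ (-ad ℂ Y) X := by
  rw [deriv_Z39_eq X hY, fderiv_exp_apply (𝕂 := ℂ), ← exp_ad_apply (𝕂 := ℂ), ← mul_apply_eq_comp, exp_ad_mul_gSer_ad,
    ad_neg]

/-- (40), the linear term as the printed series: `∂_u Z39(0) = Σ_n ((−1)ⁿ/(n+1)!) (−ad_Y)ⁿ X`.
[cite: Balaban1985Averaging, (40) p.23] -/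
theorem deriv_Z39_eq_tsum (X : 𝔸) {Y : 𝔸} (hY : ‖Y‖ ≤ 1 / 12) :
    deriv (Z39 X Y) 0 = ∑' n : ℕ, ((-1) ^ n * ((n + 1)! : ℂ)⁻¹) • ((-ad ℂ Y) ^ n) X := by
  rw [deriv_Z39_eq_gSer X hY, gSer_apply_eq_tsum]

/-- `G40 X Y = g(−i ad_Y) X` for `‖Y‖ ≤ 1/12`: the linear term of (41) in its printed closed form.
[cite: Balaban1985Averaging, (41) p.23] -/
theorem G40_eq (X : 𝔸) {Y : 𝔸} (hY : ‖Y‖ ≤ 1 / 12) : G40 X Y = gSer ℂ (-(I • ad ℂ Y)) X := by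
  have hY' : ‖(I • Y : 𝔸)‖ ≤ 1 / 12 := by rwa [norm_I_smul']
  rw [G40, deriv_Z39_eq_gSer (I • X) hY', map_smul, smul_smul, inv_mul_cancel₀ I_ne_zero, one_smul, ad_smul]

/-- **(41) AS PRINTED, LINEAR TERM INCLUDED**: for `‖X‖ < 1/3`, `‖Y‖ ≤ 1/12`,
`(1/i) log e^{iX+iY}e^{−iY} = g(−i ad_Y)X + R` with `‖R‖ ≤ 34‖X‖²` (`R = B7Eq38Remainder.R41 X Y`; print: `O(|X|²)`).
[cite: Balaban1985Averaging, (41) p.23] -/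
theorem eq41_closed_form {X Y : 𝔸} (hX : ‖X‖ < 1 / 3) (hY : ‖Y‖ ≤ 1 / 12) :
    (I⁻¹ : ℂ) • mlog (exp (I • X + I • Y) * exp (-(I • Y))) = gSer ℂ (-(I • ad ℂ Y)) X + R41 X Y ∧
      ‖R41 X Y‖ ≤ 34 * ‖X‖ ^ 2 := by
  rw [← G40_eq X hY]
  exact eq41_printed hX hY

end Algebra

end Literature.MathematicalPhysics.QuantumFieldTheory.Balaban1983to89.B7Eq32ExpDifferential
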